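import Summits.QuantumFields.YangMills.Theorems.FluctuationComparisonRegPrIntLS2BetaSignedCombLipschitz
import Summits.QuantumFields.YangMills.Theorems.FluctuationComparisonRegPrIntLS2BetaCornerOfRecord
import Literature.MathematicalPhysics.QuantumFieldTheory.Balaban1983to89.MatrixLog
import HarnessLib

/-!
# S2β · DET-REP (B) — THE SIGNED COMB IS SUP-LIPSCHITZ ALONG ITS PATH: `‖T_V(x) − T_{V'}(x)‖ ≤ (d·(Lᵏ−1)∕2) · sup_ℓ ‖V ℓ − V' ℓ‖` with the
# DEPTH-HONEST constant (the number of bonds on the comb path), and the free-bond comb coordinates of two bondwise-close fields are close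

Cell `ym3-torus` (rung R3: continuum `SU(2)` Yang–Mills on `T³` — NOT `d = 4`, NOT infinite volume, NOT a mass gap, NOT Clay); seat
`ymfull-r3-prover-4` g0 (R590-ym (a) item (4), DET-REP (B)); definition-free helper of the crux `stmt-QuantumFields-20520`
(`--supports … --as helper`, NOT a proof of it and NOT a proof of any registered stub).  Lane: the kinematic letter CLOSE-AXIAL-MIN of (Q-TUBE)
(HOME `ymfull-r3-prover-4/g0/FINDING-QTUBE-KINEMATIC-r3p4g0.md`; ymfull-r3-prover-3 g0's Q-COMB-DEPTH split, ★★OWNER №189).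

WHY.  px21 g17's COVER row (F6) (✓`…TreeGaugeChartLocalCover`, root; lattice twins to come) puts a fine field on the slice of the tube of record through `U₀` as
soon as its RELATIVE COMB COORDINATES `(T_{U₀}(b₋)·U₀ b·T_{U₀}(b₊)⁻¹)⁻¹·(T_V(b₋)·V b·T_V(b₊)⁻¹)` (`T = combTransporter (K−J)`, ✓`…S2BetaSignedComb`) lie in the
chart window on every free bond.  For two REGULAR MINIMISERS the 19200 lineage delivers BONDWISE closeness on the interior bonds after alignment in print's axial
gauge (✓`UnitScaleTiltProp7AxialGaugeBlock.dist1_mul_inv_le_interior`: `dist1(W_b·U₀,b⁻¹) ≤ d(Lᵏ−1)(δ_W+δ₀) = O(ε₀η)`), and the inter-block bonds are the open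
letter (β).  What converts BONDWISE closeness into closeness of the COMB COORDINATES is a Lipschitz bound for `V ↦ T_V(x)` whose constant is the LENGTH OF THE
COMB PATH — not the lattice-dependent existential constant of ✓`…SignedCombLipschitz.exists_norm_combTransporter_sub_le` (a sum over ALL bonds, fine for the
fixed-lattice row (T2), useless for a window radius chosen before the depth).  THIS FILE is that bound, by the same three inductions with a SUP hypothesis:
* §1 `norm_lineHol_sub_le_sup`, `norm_lineHolBack_sub_le_sup`, `norm_lineHolZ_sub_le_sup` — `m` (resp. `|z|`) steps ⟹ `≤ m·M` when `‖V ℓ − V' ℓ‖ ≤ M` for all `ℓ`;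
  ★ `norm_pathHolZ_sub_le_sup` — along a duplicate-free axis list `l` from `a` aimed at `x`: `≤ (Σ_{ν ∈ l} |x_ν − a_ν|)·M` (labels read in `ℕ`).
* §2 ★★ `norm_combTransporter_sub_le_sup` — `‖T_V(x) − T_{V'}(x)‖ ≤ (d·((Lᵏ−1)∕2))·M` (px21's ✓`val_rootOf_le`: every coordinate of `x` is within `(Lᵏ−1)∕2` of
  its root's), for EVERY lattice of the tower and every `k ≤ m + K` — the constant is the comb's reach in fine units, so with `M = O(ε₀·L^{−k})` (the interior
  closeness of two regular fields at depth `k`) the product is `O(d·ε₀)`, DEPTH-FREE.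
* §3 ★★ `norm_combCoord_sub_le_sup` — the free-bond comb coordinates: `‖T_{V'}(b₋)·V' b·T_{V'}(b₊)⁻¹ − T_V(b₋)·V b·T_V(b₊)⁻¹‖ ≤ (2·d·((Lᵏ−1)∕2) + 1)·M` for EVERY bond,
  and ★ `dist1_combCoord_rel_le_sup` — the RELATIVE coordinate `(T_V … )⁻¹·(T_{V'} …)` is within the same bound of `1` in `dist1` (left multiplication by a unitary).
* §4 ★ `mem_window_half_of_dist1_le` — `SU(2)`: `dist1 g ≤ t`, `t < r_C`, `t ≤ ½`, `2t < s_C∕2` ⟹ `g ∈ window (s_C∕2)` for the chart of record (`window_eq` +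
  lit `norm_mlog_le_two_mul`; numerically `r_C = ⅓`, `s_C = log(4∕3)` by lit `innerRadius_su2`∕`chartRadius_su2`, so `t ≤ 1∕20` will do).
* §5 ★★★ `slice_of_bondwiseClose` — THE (Q-TUBE) KNIT, with px21 g17's docked COVER row (F6) (✓∕⧗`…TubularChartDockLocalWinId.exists_tubularHaarChart_pivotAct_local_winId`,
  last conjunct, TOKEN FOR TOKEN) DISPLAYED as the hypothesis `hF6`: a fine field `W` that is BONDWISE `M`-close to the base `U₀` with `(2·d·((Lᵏ−1)∕2) + 1)·M` below the chart thresholds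
  (`< r_C`, `≤ ½`, twice it `< s_C∕2`; `k = K − J`) lies on the slice modulo the group — `∃ y ∈ UV, ∃ w, W = pivotAct ι (w, pivots) (σ y)`; and ★★★ `qTube_of_bondwiseClose_gaugeAct` — the same for ANY
  fine field `u` one of whose RESIDUAL-GAUGE translates `w' • u` is bondwise `M`-close to `U₀`: `∃ k, ∃ y ∈ UV, pivotAct ι k (σ y) = u` — the letter (Q-TUBE) of
  ✓`…S2BetaCornerInTube.cornerRows_text_of_pivotAct_eq` (p784096) in the shape it consumes (`0 < jV y` by ✓`…S2BetaTubeOfRecordFramed`).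
So (Q-TUBE) at a corner ⟸ **CLOSE-BOND-MIN** «some residual translate of the corner's minimiser is bondwise `M`-close to the base minimiser, `(d(Lᵏ−1)+1)·M` below the fixed chart thresholds `r_C = ⅓`, `s_C∕4`»
+ COVER (F6).  CLOSE-BOND-MIN's interior-bond half is ✓`UnitScaleTiltProp7AxialGaugeBlock.dist1_mul_inv_le_interior` in print's axial gauge (`M = d(Lᵏ−1)·2ε₀·L^{−2k}`,
so `(d(Lᵏ−1)+1)·M ≤ 2d²ε₀ + …` — DEPTH-FREE, small with the organ's `ε₁`); its inter-block half is the open kinematic letter (β) ([Balaban1985RegularSpaces] Lemma 1 (1.25)–(1.26)).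

HONEST SCOPE.  Finitely many products of unitaries (lattice bookkeeping); def-free; default heartbeats; proves nothing of (β), COVER, (Q-TUBE), DET-REP (B), GAP♯,
S2β or the crux 20520; finite-volume∕conditional programme; `YM3TorusSU2` NOT proved; rung R3 = SU(2) YM₃ on T³ — NOT d = 4, NOT infinite volume, NOT a mass gap,
NOT Clay; the Yang–Mills mass gap is NOT proved.

References: [Balaban1985Averaging] CMP 98 (1985) (8) p. 19, pp. 24–25; [Balaban1985RegularSpaces] CMP 99 (1985) (1.19), Lemma 1 (1.25) p. 79;
[Balaban1985Variational] CMP 102 (1985) (19) p. 281; [Balaban1987RG1] CMP 109 (1987) (0.1) pp. 251–252.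
-/

noncomputable section

open Function
open scoped Matrix.Norms.L2Operator
open Literature.MathematicalPhysics.QuantumFieldTheory.Balaban1983to89
open Literature.MathematicalPhysics.QuantumFieldTheory.Balaban1983to89.T4RootedResidualGauge (shiftN lineHol lineHol_succ rootOf)
open Literature.MathematicalPhysics.QuantumFieldTheory.Balaban1983to89.B15DeterminingSets (embIter)
open Summit.QuantumFields.YangMills.Theorems.FluctuationComparisonRegPrIntLS2BetaSignedComb
open Summit.QuantumFields.YangMills.Theorems.FluctuationComparisonRegPrIntLS2BetaSignedCombKill
open Summit.QuantumFields.YangMills.Theorems.FluctuationComparisonRegPrIntLS2BetaSignedCombLipschitz (dist1_mul_inv_eq_norm_sub)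
open Summit.QuantumFields.YangMills.Theorems.PoincareLipschitzOneStep (norm_coe_mul_sub_le)
open Summit.QuantumFields.YangMills.Theorems.AvgCurvGrad (norm_coe_inv_sub_inv)

namespace Summit.QuantumFields.YangMills.Theorems.FluctuationComparisonRegPrIntLS2BetaSignedCombSupLipschitz

/-! ## §1 Straight and coordinate-path holonomies: Lipschitz in the SUP of the bond distances, constant = number of steps -/

section Holonomy

variable {P : Params} {j : ℕ} {n : Type*} [Fintype n] [DecidableEq n] [Nonempty n]

/-- A forward straight holonomy of `m` steps moves by at most `m·M` when every bond variable moves by at most `M`. [cite: Balaban1985Averaging, (8) p.19 (bookkeeping)] -/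
theorem norm_lineHol_sub_le_sup (a : Site P j) (μ : Fin P.d) {M : ℝ}
    {V V' : GaugeField P j (Matrix.specialUnitaryGroup n ℂ)}
    (hM : ∀ ℓ : PBond P j, ‖((V ℓ : Matrix.specialUnitaryGroup n ℂ) : Matrix n n ℂ) - ((V' ℓ : Matrix.specialUnitaryGroup n ℂ) : Matrix n n ℂ)‖ ≤ M) :
    ∀ m : ℕ, ‖((lineHol V a μ m : Matrix.specialUnitaryGroup n ℂ) : Matrix n n ℂ) - ((lineHol V' a μ m : Matrix.specialUnitaryGroup n ℂ) : Matrix n n ℂ)‖ ≤ m * M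
  | 0 => by simp
  | m + 1 => by
      rw [lineHol_succ, lineHol_succ]
      calc _ ≤ ‖((lineHol V a μ m : Matrix.specialUnitaryGroup n ℂ) : Matrix n n ℂ) - ((lineHol V' a μ m : Matrix.specialUnitaryGroup n ℂ) : Matrix n n ℂ)‖ +
            ‖((V ⟨shiftN a μ m, μ⟩ : Matrix.specialUnitaryGroup n ℂ) : Matrix n n ℂ) - ((V' ⟨shiftN a μ m, μ⟩ : Matrix.specialUnitaryGroup n ℂ) : Matrix n n ℂ)‖ :=
            norm_coe_mul_sub_le _ _ _ _
        _ ≤ m * M + M := add_le_add (norm_lineHol_sub_le_sup a μ hM m) (hM _)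
        _ = ((m + 1 : ℕ) : ℝ) * M := by push_cast; ring

/-- A backward straight holonomy of `m` steps moves by at most `m·M` (inverted variables: `‖A⁻¹ − A'⁻¹‖ = ‖A − A'‖`). [cite: Balaban1985Averaging, (8) p.19 (bookkeeping)] -/
theorem norm_lineHolBack_sub_le_sup (a : Site P j) (μ : Fin P.d) {M : ℝ}
    {V V' : GaugeField P j (Matrix.specialUnitaryGroup n ℂ)}
    (hM : ∀ ℓ : PBond P j, ‖((V ℓ : Matrix.specialUnitaryGroup n ℂ) : Matrix n n ℂ) - ((V' ℓ : Matrix.specialUnitaryGroup n ℂ) : Matrix n n ℂ)‖ ≤ M) :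
    ∀ m : ℕ, ‖((lineHolBack V a μ m : Matrix.specialUnitaryGroup n ℂ) : Matrix n n ℂ) - ((lineHolBack V' a μ m : Matrix.specialUnitaryGroup n ℂ) : Matrix n n ℂ)‖ ≤ m * M
  | 0 => by simp
  | m + 1 => by
      rw [lineHolBack_succ, lineHolBack_succ]
      calc _ ≤ ‖((lineHolBack V a μ m : Matrix.specialUnitaryGroup n ℂ) : Matrix n n ℂ) - ((lineHolBack V' a μ m : Matrix.specialUnitaryGroup n ℂ) : Matrix n n ℂ)‖ +
            ‖(((V ⟨shiftZ a μ (-((m : ℤ) + 1)), μ⟩)⁻¹ : Matrix.specialUnitaryGroup n ℂ) : Matrix n n ℂ) -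
              (((V' ⟨shiftZ a μ (-((m : ℤ) + 1)), μ⟩)⁻¹ : Matrix.specialUnitaryGroup n ℂ) : Matrix n n ℂ)‖ :=
            norm_coe_mul_sub_le _ _ _ _
        _ ≤ m * M + M := by
            refine add_le_add (norm_lineHolBack_sub_le_sup a μ hM m) ?_
            rw [norm_coe_inv_sub_inv]
            exact hM _
        _ = ((m + 1 : ℕ) : ℝ) * M := by push_cast; ring

/-- A signed straight holonomy of `z` steps moves by at most `|z|·M`. [cite: Balaban1985Averaging, (8) p.19 (bookkeeping)] -/
theorem norm_lineHolZ_sub_le_sup (a : Site P j) (μ : Fin P.d) {M : ℝ}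
    {V V' : GaugeField P j (Matrix.specialUnitaryGroup n ℂ)}
    (hM : ∀ ℓ : PBond P j, ‖((V ℓ : Matrix.specialUnitaryGroup n ℂ) : Matrix n n ℂ) - ((V' ℓ : Matrix.specialUnitaryGroup n ℂ) : Matrix n n ℂ)‖ ≤ M) :
    ∀ z : ℤ, ‖((lineHolZ V a μ z : Matrix.specialUnitaryGroup n ℂ) : Matrix n n ℂ) - ((lineHolZ V' a μ z : Matrix.specialUnitaryGroup n ℂ) : Matrix n n ℂ)‖ ≤ z.natAbs * M
  | Int.ofNat m => by
      rw [show (Int.ofNat m : ℤ) = (m : ℤ) from rfl, lineHolZ_natCast, lineHolZ_natCast, Int.natAbs_natCast]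
      exact norm_lineHol_sub_le_sup a μ hM m
  | Int.negSucc m => by
      rw [lineHolZ_negSucc, lineHolZ_negSucc, Int.natAbs_negSucc]
      exact norm_lineHolBack_sub_le_sup a μ hM (m + 1)

/-- ★ **A SIGNED COORDINATE-PATH HOLONOMY MOVES BY AT MOST (NUMBER OF STEPS)·M**: along a duplicate-free axis list `l` from `a` aimed at `x`,
`‖hol_V − hol_{V'}‖ ≤ (Σ_{ν ∈ l} |x_ν − a_ν|)·M` (labels in `ℕ`; after the `μ`-segment the later steps are unchanged because `μ ∉ l`).
[cite: Balaban1985Averaging, (8) p.19 (bookkeeping)] -/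
theorem norm_pathHolZ_sub_le_sup (x : Site P j) {M : ℝ}
    {V V' : GaugeField P j (Matrix.specialUnitaryGroup n ℂ)}
    (hM : ∀ ℓ : PBond P j, ‖((V ℓ : Matrix.specialUnitaryGroup n ℂ) : Matrix n n ℂ) - ((V' ℓ : Matrix.specialUnitaryGroup n ℂ) : Matrix n n ℂ)‖ ≤ M) :
    ∀ (l : List (Fin P.d)), l.Nodup → ∀ (a : Site P j),
      ‖((pathHolZ V a x l : Matrix.specialUnitaryGroup n ℂ) : Matrix n n ℂ) - ((pathHolZ V' a x l : Matrix.specialUnitaryGroup n ℂ) : Matrix n n ℂ)‖ ≤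
        ((l.map fun ν => (((x ν).val : ℤ) - ((a ν).val : ℤ)).natAbs).sum : ℕ) * M
  | [], _, a => by simp [pathHolZ]
  | μ :: l, hnd, a => by
      obtain ⟨hμ, hl⟩ := List.nodup_cons.1 hnd
      rw [pathHolZ, pathHolZ]
      have ih := norm_pathHolZ_sub_le_sup x hM l hl (shiftZ a μ (((x μ).val : ℤ) - ((a μ).val : ℤ)))
      -- the later steps, read from the point reached after the `μ`-segment, are those read from `a`
      have hmap : (l.map fun ν => (((x ν).val : ℤ) - (((shiftZ a μ (((x μ).val : ℤ) - ((a μ).val : ℤ))) ν).val : ℤ)).natAbs) =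
          l.map fun ν => (((x ν).val : ℤ) - ((a ν).val : ℤ)).natAbs := by
        refine List.map_congr_left fun ν hν => ?_
        have hne : ν ≠ μ := fun h => hμ (h ▸ hν)
        rw [shiftZ_apply_of_ne a hne]
      rw [hmap] at ih
      calc _ ≤ ‖((lineHolZ V a μ (((x μ).val : ℤ) - ((a μ).val : ℤ)) : Matrix.specialUnitaryGroup n ℂ) : Matrix n n ℂ) -
              ((lineHolZ V' a μ (((x μ).val : ℤ) - ((a μ).val : ℤ)) : Matrix.specialUnitaryGroup n ℂ) : Matrix n n ℂ)‖ +
            ‖((pathHolZ V (shiftZ a μ (((x μ).val : ℤ) - ((a μ).val : ℤ))) x l : Matrix.specialUnitaryGroup n ℂ) : Matrix n n ℂ) -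
              ((pathHolZ V' (shiftZ a μ (((x μ).val : ℤ) - ((a μ).val : ℤ))) x l : Matrix.specialUnitaryGroup n ℂ) : Matrix n n ℂ)‖ :=
            norm_coe_mul_sub_le _ _ _ _
        _ ≤ (((x μ).val : ℤ) - ((a μ).val : ℤ)).natAbs * M +
            ((l.map fun ν => (((x ν).val : ℤ) - ((a ν).val : ℤ)).natAbs).sum : ℕ) * M :=
            add_le_add (norm_lineHolZ_sub_le_sup a μ hM _) ih
        _ = (((μ :: l).map fun ν => (((x ν).val : ℤ) - ((a ν).val : ℤ)).natAbs).sum : ℕ) * M := by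
            rw [List.map_cons, List.sum_cons]; push_cast; ring

end Holonomy

/-! ## §2 The comb transporter: constant = the comb's reach `d·((Lᵏ−1)∕2)` -/

section Comb

variable {P : Params} {k : ℕ} {n : Type*} [Fintype n] [DecidableEq n] [Nonempty n]

/-- The signed offsets from the root add up to at most `d·((Lᵏ−1)∕2)` (px21's ✓`val_rootOf_le`, coordinate by coordinate).
[cite: Balaban1987RG1, (0.1) pp.251-252 (bookkeeping)] -/
theorem sum_natAbs_offset_le (hk : k ≤ P.m + P.K) (x : Site P 0) :
    ((List.finRange P.d).map fun ν => (((x ν).val : ℤ) - (((rootOf k x) ν).val : ℤ)).natAbs).sum ≤ P.d * ((P.L ^ k - 1) / 2) := by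
  have hb : ∀ ν ∈ List.finRange P.d, (((x ν).val : ℤ) - (((rootOf k x) ν).val : ℤ)).natAbs ≤ (P.L ^ k - 1) / 2 := by
    intro ν _
    have h := val_rootOf_le (P := P) hk x ν
    omega
  calc ((List.finRange P.d).map fun ν => (((x ν).val : ℤ) - (((rootOf k x) ν).val : ℤ)).natAbs).sum
      ≤ ((List.finRange P.d).map fun _ => (P.L ^ k - 1) / 2).sum := List.sum_le_sum (fun ν hν => hb ν hν)
    _ = P.d * ((P.L ^ k - 1) / 2) := by simp

/-- ★★ **THE COMB TRANSPORTER IS SUP-LIPSCHITZ WITH THE DEPTH-HONEST CONSTANT**: `‖T_V(x) − T_{V'}(x)‖ ≤ (d·((Lᵏ−1)∕2))·sup_ℓ ‖V ℓ − V' ℓ‖` on every torus of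
the tower and for every `k ≤ m + K`. [cite: Balaban1985Variational, (19) p.281; Balaban1985RegularSpaces, (1.19) p.79] -/
theorem norm_combTransporter_sub_le_sup (hk : k ≤ P.m + P.K) {M : ℝ} (hM0 : 0 ≤ M)
    {V V' : GaugeField P 0 (Matrix.specialUnitaryGroup n ℂ)}
    (hM : ∀ ℓ : PBond P 0, ‖((V ℓ : Matrix.specialUnitaryGroup n ℂ) : Matrix n n ℂ) - ((V' ℓ : Matrix.specialUnitaryGroup n ℂ) : Matrix n n ℂ)‖ ≤ M)
    (x : Site P 0) :
    ‖((combTransporter k V x : Matrix.specialUnitaryGroup n ℂ) : Matrix n n ℂ) - ((combTransporter k V' x : Matrix.specialUnitaryGroup n ℂ) : Matrix n n ℂ)‖ ≤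
      (P.d * ((P.L ^ k - 1) / 2) : ℕ) * M := by
  unfold combTransporter
  refine (norm_pathHolZ_sub_le_sup x hM (List.finRange P.d) (List.nodup_finRange P.d) (rootOf k x)).trans ?_
  exact mul_le_mul_of_nonneg_right (by exact_mod_cast sum_natAbs_offset_le hk x) hM0

/-! ## §3 The free-bond comb coordinates of two bondwise-close fields are close -/

/-- ★★ **THE COMB COORDINATES ARE SUP-LIPSCHITZ**: for every bond `b`, `‖T_{V'}(b₋)·V' b·T_{V'}(b₊)⁻¹ − T_V(b₋)·V b·T_V(b₊)⁻¹‖ ≤ (2·d·((Lᵏ−1)∕2) + 1)·M`.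
[cite: Balaban1985Variational, (19) p.281; Balaban1985RegularSpaces, Lemma 1 (1.25) p.79] -/
theorem norm_combCoord_sub_le_sup (hk : k ≤ P.m + P.K) {M : ℝ} (hM0 : 0 ≤ M)
    {V V' : GaugeField P 0 (Matrix.specialUnitaryGroup n ℂ)}
    (hM : ∀ ℓ : PBond P 0, ‖((V ℓ : Matrix.specialUnitaryGroup n ℂ) : Matrix n n ℂ) - ((V' ℓ : Matrix.specialUnitaryGroup n ℂ) : Matrix n n ℂ)‖ ≤ M)
    (b : PBond P 0) :
    ‖((combTransporter k V' b.src * V' b * (combTransporter k V' b.tgt)⁻¹ : Matrix.specialUnitaryGroup n ℂ) : Matrix n n ℂ) -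
        ((combTransporter k V b.src * V b * (combTransporter k V b.tgt)⁻¹ : Matrix.specialUnitaryGroup n ℂ) : Matrix n n ℂ)‖ ≤
      (2 * (P.d * ((P.L ^ k - 1) / 2) : ℕ) + 1) * M := by
  set A : Matrix.specialUnitaryGroup n ℂ := combTransporter k V b.src with hA
  set B : Matrix.specialUnitaryGroup n ℂ := V b with hB
  set C : Matrix.specialUnitaryGroup n ℂ := combTransporter k V b.tgt with hC
  set A' : Matrix.specialUnitaryGroup n ℂ := combTransporter k V' b.src with hA'
  set B' : Matrix.specialUnitaryGroup n ℂ := V' b with hB'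
  set C' : Matrix.specialUnitaryGroup n ℂ := combTransporter k V' b.tgt with hC'
  have hM' : ∀ ℓ : PBond P 0, ‖((V' ℓ : Matrix.specialUnitaryGroup n ℂ) : Matrix n n ℂ) - ((V ℓ : Matrix.specialUnitaryGroup n ℂ) : Matrix n n ℂ)‖ ≤ M :=
    fun ℓ => by rw [norm_sub_rev]; exact hM ℓ
  have h1 : ‖(A' : Matrix n n ℂ) - (A : Matrix n n ℂ)‖ ≤ (P.d * ((P.L ^ k - 1) / 2) : ℕ) * M :=
    norm_combTransporter_sub_le_sup (n := n) hk hM0 hM' b.src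
  have h2 : ‖(C' : Matrix n n ℂ) - (C : Matrix n n ℂ)‖ ≤ (P.d * ((P.L ^ k - 1) / 2) : ℕ) * M :=
    norm_combTransporter_sub_le_sup (n := n) hk hM0 hM' b.tgt
  have h3 : ‖(B' : Matrix n n ℂ) - (B : Matrix n n ℂ)‖ ≤ M := hM' b
  have hab : ‖((A' * B' : Matrix.specialUnitaryGroup n ℂ) : Matrix n n ℂ) - ((A * B : Matrix.specialUnitaryGroup n ℂ) : Matrix n n ℂ)‖ ≤
      ‖(A' : Matrix n n ℂ) - (A : Matrix n n ℂ)‖ + ‖(B' : Matrix n n ℂ) - (B : Matrix n n ℂ)‖ := norm_coe_mul_sub_le A' A B' B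
  have hc : ‖((C'⁻¹ : Matrix.specialUnitaryGroup n ℂ) : Matrix n n ℂ) - ((C⁻¹ : Matrix.specialUnitaryGroup n ℂ) : Matrix n n ℂ)‖ =
      ‖(C' : Matrix n n ℂ) - (C : Matrix n n ℂ)‖ := norm_coe_inv_sub_inv C' C
  have habc : ‖((A' * B' * C'⁻¹ : Matrix.specialUnitaryGroup n ℂ) : Matrix n n ℂ) - ((A * B * C⁻¹ : Matrix.specialUnitaryGroup n ℂ) : Matrix n n ℂ)‖ ≤
      ‖((A' * B' : Matrix.specialUnitaryGroup n ℂ) : Matrix n n ℂ) - ((A * B : Matrix.specialUnitaryGroup n ℂ) : Matrix n n ℂ)‖ +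
        ‖((C'⁻¹ : Matrix.specialUnitaryGroup n ℂ) : Matrix n n ℂ) - ((C⁻¹ : Matrix.specialUnitaryGroup n ℂ) : Matrix n n ℂ)‖ :=
    norm_coe_mul_sub_le (A' * B') (A * B) C'⁻¹ C⁻¹
  have hsum : ‖((A' * B' * C'⁻¹ : Matrix.specialUnitaryGroup n ℂ) : Matrix n n ℂ) - ((A * B * C⁻¹ : Matrix.specialUnitaryGroup n ℂ) : Matrix n n ℂ)‖ ≤
      ((P.d * ((P.L ^ k - 1) / 2) : ℕ) * M + M) + (P.d * ((P.L ^ k - 1) / 2) : ℕ) * M := by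
    rw [hc] at habc
    linarith
  have heq : ((P.d * ((P.L ^ k - 1) / 2) : ℕ) * M + M) + (P.d * ((P.L ^ k - 1) / 2) : ℕ) * M = (2 * (P.d * ((P.L ^ k - 1) / 2) : ℕ) + 1) * M := by
    push_cast; ring
  rw [heq] at hsum
  exact hsum

/-- ★ **THE RELATIVE COMB COORDINATE IS CLOSE TO `1`** (the shape px21's COVER row reads): `dist1((T_V(b₋)·V b·T_V(b₊)⁻¹)⁻¹·(T_{V'}(b₋)·V' b·T_{V'}(b₊)⁻¹)) ≤
(2·d·((Lᵏ−1)∕2) + 1)·M` — left multiplication by a unitary is an isometry. [cite: Balaban1985RegularSpaces, Lemma 1 (1.25) p.79] -/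
theorem dist1_combCoord_rel_le_sup (hk : k ≤ P.m + P.K) {M : ℝ} (hM0 : 0 ≤ M)
    {V V' : GaugeField P 0 (Matrix.specialUnitaryGroup n ℂ)}
    (hM : ∀ ℓ : PBond P 0, ‖((V ℓ : Matrix.specialUnitaryGroup n ℂ) : Matrix n n ℂ) - ((V' ℓ : Matrix.specialUnitaryGroup n ℂ) : Matrix n n ℂ)‖ ≤ M)
    (b : PBond P 0) :
    dist1 ((combTransporter k V b.src * V b * (combTransporter k V b.tgt)⁻¹)⁻¹ *
        (combTransporter k V' b.src * V' b * (combTransporter k V' b.tgt)⁻¹)) ≤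
      (2 * (P.d * ((P.L ^ k - 1) / 2) : ℕ) + 1) * M := by
  -- `dist1 (A⁻¹ B) = dist1 (A⁻¹ (B⁻¹)⁻¹) = ‖A⁻¹ − B⁻¹‖ = ‖A − B‖ = ‖B − A‖`
  have h := dist1_mul_inv_eq_norm_sub (n := n) (combTransporter k V b.src * V b * (combTransporter k V b.tgt)⁻¹)⁻¹
    (combTransporter k V' b.src * V' b * (combTransporter k V' b.tgt)⁻¹)⁻¹
  rw [inv_inv] at h
  rw [h, norm_coe_inv_sub_inv, norm_sub_rev]
  exact norm_combCoord_sub_le_sup (n := n) hk hM0 hM b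

end Comb


/-! ## §4 `SU(2)`: a `dist1`-small element lies in the half-window of the chart of record -/

section Window

open Literature.MathematicalPhysics.QuantumFieldTheory.Balaban1983to89.HaarExponentialChart
open Literature.MathematicalPhysics.QuantumFieldTheory.Balaban1983to89.HaarExponentialChart.IsChartRep
open Literature.MathematicalPhysics.QuantumLattice (fundamentalRep fundamentalRep_apply)

/-- ★ **A `dist1`-SMALL ELEMENT OF `SU(2)` LIES IN THE HALF-WINDOW OF THE CHART OF RECORD**: `dist1 g ≤ t`, `t < r_C`, `t ≤ ½`, `2t < s_C∕2` ⟹ `g ∈ V_{s_C∕2}`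
(`window_eq`: `‖g − 1‖ < r_C` and `‖log g‖ ≤ 2‖g − 1‖`; for the `SU(2)` chart `r_C = ⅓`, `s_C = log(4∕3)` — lit `innerRadius_su2`∕`chartRadius_su2` — so `t ≤ 1∕20` will do).
[cite: Helgason2000, Ch. I §1 Thm 1.14 (13) p.96] -/
theorem mem_window_half_of_dist1_le (g : Matrix.specialUnitaryGroup (Fin 2) ℂ) {t : ℝ} (hg : dist1 g ≤ t)
    (hti : t < IsChartRep.innerRadius (specialUnitaryLogChart (Fin 2))) (ht2 : t ≤ 1 / 2)
    (hts : 2 * t < IsChartRep.chartRadius (specialUnitaryLogChart (Fin 2)) / 2) :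
    g ∈ (isChartRep_specialUnitaryGroup (n := Fin 2)).window (IsChartRep.chartRadius (specialUnitaryLogChart (Fin 2)) / 2) := by
  have hs : IsChartRep.chartRadius (specialUnitaryLogChart (Fin 2)) / 2 ≤ IsChartRep.chartRadius (specialUnitaryLogChart (Fin 2)) :=
    half_le_self IsChartRep.chartRadius_pos.le
  rw [(isChartRep_specialUnitaryGroup (n := Fin 2)).window_eq hs]
  have hd : dist1 g = ‖((g : Matrix.specialUnitaryGroup (Fin 2) ℂ) : Matrix (Fin 2) (Fin 2) ℂ) - 1‖ := rfl
  have hg' : ‖fundamentalRep (Fin 2) g - 1‖ ≤ t := by rw [fundamentalRep_apply, ← hd]; exact hg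
  refine ⟨lt_of_le_of_lt hg' hti, ?_⟩
  have h2 : ‖MatrixLog.mlog (fundamentalRep (Fin 2) g)‖ ≤ 2 * ‖fundamentalRep (Fin 2) g - 1‖ :=
    MatrixLog.norm_mlog_le_two_mul (hg'.trans ht2)
  show ‖MatrixLog.mlog (fundamentalRep (Fin 2) g)‖ < IsChartRep.chartRadius (specialUnitaryLogChart (Fin 2)) / 2
  linarith

end Window

/-! ## §5 THE (Q-TUBE) KNIT: bondwise closeness to the base + COVER (F6) ⟹ on the slice modulo the group -/

section Knit

open Filter Topology Set
open Literature.MathematicalPhysics.QuantumFieldTheory.Balaban1983to89.T3ContinuumYM3Torus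
open Literature.MathematicalPhysics.QuantumFieldTheory.Balaban1983to89.HaarExponentialChart
open Literature.MathematicalPhysics.QuantumFieldTheory.Balaban1983to89.LogChartProduct
open Summit.QuantumFields.YangMills.Theorems.FluctuationComparisonRegPrIntLWregChain (iterCentralBond iterCentralBond_injective)
open Summit.QuantumFields.YangMills.Theorems.FluctuationComparisonRegPrIntLS2BetaResidualSubgroup
open Summit.QuantumFields.YangMills.Theorems.FluctuationComparisonRegPrIntLS2BetaResidualGauge (gaugeAct_inv_gaugeAct)

variable (F : T3Family) {J K : ℕ} (hJK : J ≤ K)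

/-- ★★★ **ON THE SLICE FROM BONDWISE CLOSENESS** — px21 g17's docked COVER row (F6) displayed as `hF6` (its text, for the tube ⟨σ, UV⟩ through `U₀`): a fine field
`W` with `‖W ℓ − U₀ ℓ‖ ≤ M` on EVERY bond and `(2·d·((Lᵏ−1)∕2) + 1)·M` below the chart thresholds (`k = K − J`) has every relative comb coordinate in the half-window (§3 + §4), hence
`∃ y ∈ UV, ∃ w, W = pivotAct ι (w, c ↦ W(ι c)·U₀(ι c)⁻¹) (σ y)`. [cite: Balaban1985RegularSpaces, Lemma 1 (1.25) p.79; Helgason2000, Ch. I §1 Thm 1.14 p.96] -/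
theorem slice_of_bondwiseClose (hk : K - J ≤ (F.P K).m + (F.P K).K)
    {dV : ℕ} {U₀ : GaugeField (F.P K) 0 (Matrix.specialUnitaryGroup (Fin 2) ℂ)}
    {σ : EuclideanSpace ℝ (Fin dV) → GaugeField (F.P K) 0 (Matrix.specialUnitaryGroup (Fin 2) ℂ)}
    {UV : Set (EuclideanSpace ℝ (Fin dV))}
    (hF6 : ∀ V' : GaugeField (F.P K) 0 (Matrix.specialUnitaryGroup (Fin 2) ℂ),
        (∀ (b : PBond (F.P K) 0) (hb : b ∉ (combSet (K - J) : Set (PBond (F.P K) 0)) ∪ Set.range (iterCentralBond (P := F.P K) (K - J))),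
          (combTransporter (K - J) U₀ b.src * U₀ b * (combTransporter (K - J) U₀ b.tgt)⁻¹)⁻¹ *
              (combTransporter (K - J) V' b.src * V' b * (combTransporter (K - J) V' b.tgt)⁻¹) ∈
            (isChartRep_specialUnitaryGroup (n := Fin 2)).window (IsChartRep.chartRadius (specialUnitaryLogChart (Fin 2)) / 2)) →
        ∃ y ∈ UV, ∃ w : residualSubgroup F hJK,
          (w : Site (F.P K) 0 → Matrix.specialUnitaryGroup (Fin 2) ℂ) = (fun x => (combTransporter (K - J) V' x)⁻¹ * combTransporter (K - J) U₀ x) ∧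
          V' = pivotAct F hJK (iterCentralBond (P := F.P K) (K - J))
            (w, fun c => V' (iterCentralBond (P := F.P K) (K - J) c) * (U₀ (iterCentralBond (P := F.P K) (K - J) c))⁻¹) (σ y))
    {W : GaugeField (F.P K) 0 (Matrix.specialUnitaryGroup (Fin 2) ℂ)} {M : ℝ} (hM0 : 0 ≤ M)
    (hM : ∀ ℓ : PBond (F.P K) 0, ‖((W ℓ : Matrix.specialUnitaryGroup (Fin 2) ℂ) : Matrix (Fin 2) (Fin 2) ℂ) -
      ((U₀ ℓ : Matrix.specialUnitaryGroup (Fin 2) ℂ) : Matrix (Fin 2) (Fin 2) ℂ)‖ ≤ M)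
    (hsmall₁ : (2 * ((F.P K).d * (((F.P K).L ^ (K - J) - 1) / 2) : ℕ) + 1) * M < IsChartRep.innerRadius (specialUnitaryLogChart (Fin 2)))
    (hsmall₂ : (2 * ((F.P K).d * (((F.P K).L ^ (K - J) - 1) / 2) : ℕ) + 1) * M ≤ 1 / 2)
    (hsmall₃ : 2 * ((2 * ((F.P K).d * (((F.P K).L ^ (K - J) - 1) / 2) : ℕ) + 1) * M) < IsChartRep.chartRadius (specialUnitaryLogChart (Fin 2)) / 2) :
    ∃ y ∈ UV, ∃ w : residualSubgroup F hJK,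
      W = pivotAct F hJK (iterCentralBond (P := F.P K) (K - J))
        (w, fun c => W (iterCentralBond (P := F.P K) (K - J) c) * (U₀ (iterCentralBond (P := F.P K) (K - J) c))⁻¹) (σ y) := by
  have hM' : ∀ ℓ : PBond (F.P K) 0, ‖((U₀ ℓ : Matrix.specialUnitaryGroup (Fin 2) ℂ) : Matrix (Fin 2) (Fin 2) ℂ) -
      ((W ℓ : Matrix.specialUnitaryGroup (Fin 2) ℂ) : Matrix (Fin 2) (Fin 2) ℂ)‖ ≤ M := fun ℓ => by rw [norm_sub_rev]; exact hM ℓ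
  obtain ⟨y, hy, w, -, hW⟩ := hF6 W fun b _ =>
    mem_window_half_of_dist1_le _ (dist1_combCoord_rel_le_sup (n := Fin 2) hk hM0 hM' b) hsmall₁ hsmall₂ hsmall₃
  exact ⟨y, hy, w, hW⟩

/-- ★★★ **(Q-TUBE) FROM CLOSE-BOND-MIN + COVER**: if SOME residual-gauge translate `w' • u` of a fine field `u` is bondwise `M`-close to the base `U₀` of the tube
(with the smallness of §5's first theorem), then `u` itself lies on the slice modulo the enlarged group: `∃ k, ∃ y ∈ UV, pivotAct ι k (σ y) = u` — the letter
(Q-TUBE) of ✓`…S2BetaCornerInTube.cornerRows_text_of_pivotAct_eq` (the corner rows of `DetRepB`'s `EdgeRows` follow, with `0 < jV y` from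
✓`…S2BetaTubeOfRecordFramed.exists_tubeRows_framed`).  Group bookkeeping: `k := (w'⁻¹, c ↦ u(ι c)·(w'•u)(ι c)⁻¹) · (w, c ↦ (w'•u)(ι c)·U₀(ι c)⁻¹)`.
[cite: Balaban1985RegularSpaces, Lemma 1 (1.25) p.79; Balaban1985Averaging, (8) p.19; Balaban1985Variational, Thm 1 (8) p.279] -/
theorem qTube_of_bondwiseClose_gaugeAct (hk : K - J ≤ (F.P K).m + (F.P K).K)
    {dV : ℕ} {U₀ : GaugeField (F.P K) 0 (Matrix.specialUnitaryGroup (Fin 2) ℂ)}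
    {σ : EuclideanSpace ℝ (Fin dV) → GaugeField (F.P K) 0 (Matrix.specialUnitaryGroup (Fin 2) ℂ)}
    {UV : Set (EuclideanSpace ℝ (Fin dV))}
    (hF6 : ∀ V' : GaugeField (F.P K) 0 (Matrix.specialUnitaryGroup (Fin 2) ℂ),
        (∀ (b : PBond (F.P K) 0) (hb : b ∉ (combSet (K - J) : Set (PBond (F.P K) 0)) ∪ Set.range (iterCentralBond (P := F.P K) (K - J))),
          (combTransporter (K - J) U₀ b.src * U₀ b * (combTransporter (K - J) U₀ b.tgt)⁻¹)⁻¹ *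
              (combTransporter (K - J) V' b.src * V' b * (combTransporter (K - J) V' b.tgt)⁻¹) ∈
            (isChartRep_specialUnitaryGroup (n := Fin 2)).window (IsChartRep.chartRadius (specialUnitaryLogChart (Fin 2)) / 2)) →
        ∃ y ∈ UV, ∃ w : residualSubgroup F hJK,
          (w : Site (F.P K) 0 → Matrix.specialUnitaryGroup (Fin 2) ℂ) = (fun x => (combTransporter (K - J) V' x)⁻¹ * combTransporter (K - J) U₀ x) ∧
          V' = pivotAct F hJK (iterCentralBond (P := F.P K) (K - J))
            (w, fun c => V' (iterCentralBond (P := F.P K) (K - J) c) * (U₀ (iterCentralBond (P := F.P K) (K - J) c))⁻¹) (σ y))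
    {u : GaugeField (F.P K) 0 (Matrix.specialUnitaryGroup (Fin 2) ℂ)} (w' : residualSubgroup F hJK) {M : ℝ} (hM0 : 0 ≤ M)
    (hM : ∀ ℓ : PBond (F.P K) 0,
      ‖((GaugeField.gaugeAct (w' : Site (F.P K) 0 → Matrix.specialUnitaryGroup (Fin 2) ℂ) u ℓ : Matrix.specialUnitaryGroup (Fin 2) ℂ) : Matrix (Fin 2) (Fin 2) ℂ) -
        ((U₀ ℓ : Matrix.specialUnitaryGroup (Fin 2) ℂ) : Matrix (Fin 2) (Fin 2) ℂ)‖ ≤ M)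
    (hsmall₁ : (2 * ((F.P K).d * (((F.P K).L ^ (K - J) - 1) / 2) : ℕ) + 1) * M < IsChartRep.innerRadius (specialUnitaryLogChart (Fin 2)))
    (hsmall₂ : (2 * ((F.P K).d * (((F.P K).L ^ (K - J) - 1) / 2) : ℕ) + 1) * M ≤ 1 / 2)
    (hsmall₃ : 2 * ((2 * ((F.P K).d * (((F.P K).L ^ (K - J) - 1) / 2) : ℕ) + 1) * M) < IsChartRep.chartRadius (specialUnitaryLogChart (Fin 2)) / 2) :
    ∃ (k : ↥(residualSubgroup F hJK) × (PBond (F.P K) (K - J) → Matrix.specialUnitaryGroup (Fin 2) ℂ)) (y : EuclideanSpace ℝ (Fin dV)),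
      y ∈ UV ∧ pivotAct F hJK (iterCentralBond (P := F.P K) (K - J)) k (σ y) = u := by
  set W : GaugeField (F.P K) 0 (Matrix.specialUnitaryGroup (Fin 2) ℂ) :=
    GaugeField.gaugeAct (w' : Site (F.P K) 0 → Matrix.specialUnitaryGroup (Fin 2) ℂ) u with hWdef
  obtain ⟨y, hy, w, hW⟩ := slice_of_bondwiseClose F hJK hk hF6 (W := W) hM0 hM hsmall₁ hsmall₂ hsmall₃
  refine ⟨(w'⁻¹, fun c => u (iterCentralBond (P := F.P K) (K - J) c) * (W (iterCentralBond (P := F.P K) (K - J) c))⁻¹) *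
      (w, fun c => W (iterCentralBond (P := F.P K) (K - J) c) * (U₀ (iterCentralBond (P := F.P K) (K - J) c))⁻¹), y, hy, ?_⟩
  rw [pivotAct_mul F hJK _ (iterCentralBond_injective (P := F.P K) hk), ← hW]
  funext b
  by_cases hb : ∃ c, iterCentralBond (P := F.P K) (K - J) c = b
  · obtain ⟨c, rfl⟩ := hb
    rw [pivotAct_apply_pivot F hJK _ (iterCentralBond_injective (P := F.P K) hk)]
    show u _ * (W _)⁻¹ * W _ = u _
    rw [inv_mul_cancel_right]
  · rw [pivotAct_apply_of_not_mem_range F hJK _ _ _ hb]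
    show GaugeField.gaugeAct (((w'⁻¹ : residualSubgroup F hJK)) : Site (F.P K) 0 → Matrix.specialUnitaryGroup (Fin 2) ℂ) W b = u b
    rw [Subgroup.coe_inv, hWdef, gaugeAct_inv_gaugeAct]

end Knit

end Summit.QuantumFields.YangMills.Theorems.FluctuationComparisonRegPrIntLS2BetaSignedCombSupLipschitz

end
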